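import Summits.MatrixMultiplication.MatrixMultiplication.Theses.CongruenceTowerPacking

/-!
# `CongruenceTowerPacking.Assembly` (stmt-MatrixMultiplication-12346) — beating CKSU Cor. 1.9 at
every exponent above 2 gives `ω(ℂ) = 2`

Route `MatrixMultiplication/CongruenceTowerPacking`, item `stmt-MatrixMultiplication-12346`
(assembly, rank 1):

  `CorNineteenBeaten → MatrixMultiplication`.

This is, verbatim, the type of the route's kernel-checked deciding theorem
`Summit.MatrixMultiplication.MatrixMultiplication.Theses.CongruenceTowerPacking.closes`; the proof
below replays that argument against the literal route decl without depending on `closes` itself (so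
the file survives any later re-authoring of the deciding theorem's proof script).

Argument.  `2 ≤ ω(ℂ)` is the flattening bound `omega_two_le`.  Suppose `2 < ω := ω(ℂ)`.  Apply the
target `CorNineteenBeaten` at `τ := ω`: some finite group `G` carries a triple-product-property
triple `(S, T, U)` with `d_max(G)^(ω−2)·|G| < (|S||T||U|)^(ω/3)`.  But `⟨S, T, U⟩` realizes
`⟨|S|, |T|, |U|⟩` in `G` (`RealizesTPP`, the same inlined TPP predicate), so Cohn–Kleinberg–Szegedy–
Umans 2005, Cor. 1.9 — the tree THEOREM `CKSU2005_cor19_holds` — gives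
`(|S||T||U|)^(ω/3) ≤ d_max(G)^(ω−2)·|G|`: contradiction.  Hence `ω ≤ 2`, so `ω(ℂ) = 2`, which is
`MatrixMultiplication` (`MatrixMultiplication_iff`).  No Literature fact is assumed; the tower cruxes
of the route are not hypotheses of the assembly and are not used.

References: H. Cohn, R. Kleinberg, B. Szegedy, C. Umans, *Group-theoretic algorithms for matrix
multiplication*, FOCS 2005, Cor. 1.9; H. Cohn, C. Umans, *A group-theoretic approach to fast matrix
multiplication*, FOCS 2003, Def. 2.1.
-/

-- single-conjunct summit: the mandated namespace `Summit.MatrixMultiplication.MatrixMultiplication.…`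
-- repeats `MatrixMultiplication` (summit = sub-problem), which `linter.dupNamespace` would flag.
set_option linter.dupNamespace false

namespace Summit.MatrixMultiplication.MatrixMultiplication.Theorems

open Summit.MatrixMultiplication.MatrixMultiplication.Theses.CongruenceTowerPacking in
/-- **Assembly of route CongruenceTowerPacking** (settles `stmt-MatrixMultiplication-12346`, exact
route signature `Summit.MatrixMultiplication.MatrixMultiplication.Theses.CongruenceTowerPacking.Assembly`):
if CKSU 2005 Cor. 1.9 is beaten at every exponent `τ > 2` (`CorNineteenBeaten`: some finite group `G`
and TPP triple `S, T, U ⊆ G` with `d_max(G)^(τ−2)·|G| < (|S||T||U|)^(τ/3)`), then `ω(ℂ) = 2`.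
If `ω > 2`, apply the hypothesis at `τ := ω`; the triple realizes `⟨|S|,|T|,|U|⟩` in `G`, so the tree
theorem `CKSU2005_cor19_holds` gives `(|S||T||U|)^(ω/3) ≤ d_max(G)^(ω−2)·|G|`, contradicting the strict
inequality; `2 ≤ ω` is `omega_two_le`.  Same argument as the route's deciding theorem `closes`,
replayed here self-containedly. [cite: CohnKleinbergSzegedyUmans2005, Cor. 1.9] -/
theorem congruenceTowerPacking_assembly_proof :
    Summit.MatrixMultiplication.MatrixMultiplication.Theses.CongruenceTowerPacking.Assembly := by
  unfold Summit.MatrixMultiplication.MatrixMultiplication.Theses.CongruenceTowerPacking.Assembly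
    Summit.MatrixMultiplication.MatrixMultiplication.Theses.CongruenceTowerPacking.CorNineteenBeaten
  intro h
  rw [_root_.MatrixMultiplication_iff]
  refine le_antisymm (not_lt.1 fun hlt => ?_)
    (Literature.Computability.AlgebraicComplexity.omega_two_le ℂ)
  -- the target at τ := ω(ℂ) > 2
  obtain ⟨G, _, _, S, T, U, hTPP, hbeat⟩ := h _ hlt
  -- Cohn–Umans (CKSU 2005 Cor. 1.9, tree theorem) for the realised triple ⟨|S|,|T|,|U|⟩ in G
  have hreal : Literature.Computability.AlgebraicComplexity.RealizesTPP G S.card T.card U.card :=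
    ⟨S, T, U, rfl, rfl, rfl, hTPP⟩
  have hCU :=
    Literature.Computability.AlgebraicComplexity.CKSU2005_cor19_holds G S.card T.card U.card hreal
  rw [Nat.card_eq_fintype_card] at hCU
  exact lt_irrefl _ (hbeat.trans_le hCU)

end Summit.MatrixMultiplication.MatrixMultiplication.Theorems
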